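import Summits.CriticalPhenomena.PercolationContinuityZ3.Theorems.Transplant.PlanarSkeletonCentralShift
import Mathlib.Combinatorics.SimpleGraph.Cayley
import HarnessLib

/-!
# THE ABSTRACT CAYLEY-GRAPH THEOREM: a homomorphic planar skeleton `φ : Γ → ℤ²`, generator-preserving automorphisms acting on it by
# `−I` (and `diag(1,−1)`), connected cylinders and ONE finite-conjugacy-class element off `ker φ` give `θ(p_c) = 0` on `Cay(Γ; S)` —
# for EVERY group `Γ` (Mathlib `Group`, `SimpleGraph.mulCayley`)

builds on p205010 (kernel theorem, internal audit signed; external expert review pending) — the unconditional theorems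
(`CayleySign.criticalContinuity`) run through the closed D″ node `samePDropOfSkeletonSign_holds`,
whose proof uses near-one gluing (AdditiveGluing), which builds on p205010.
Lane `prim-bschramm`, seat `prim-bschramm-p4` (gen 9; PART C3 = general transitive `p_c < 1`, METHOD = abstract closing argument: INPUT(G) as
weak as possible); helper file (`--supports stmt-CriticalPhenomena-4575 --as helper`).  Memo `HOME/bschramm/P4-GENERAL.md` §25.

THE POINT (P4-GENERAL §22.2 (iii) "state the principle once").  Every Cayley-graph customer of the lane so far (`ℤ^d`, all 1,024 unit-range
`Cay(ℤ³;S)`, tall generators, `H₃(ℤ) × ℤ^k`, `N_{m,2} × ℤ`, `Cay(H₃;S) × ℤ`, …) was typed on hand-rolled coordinates.  Here the input is stated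
ONCE over an arbitrary group `Γ` with a finite generating system `S` (Mathlib's right Cayley graph `SimpleGraph.mulCayley ↑S`: `u ∼ u·s`):
* `CayleyNeg Γ S` — a map `φ : Γ → ℤ²` with `φ(gh) = φ(g) + φ(h)`, `‖φ(s)‖_∞ ≤ 1` on `S`, unit steps `φ(s_i) = e_i` for some `s_i ∈ S`, ONE group
  automorphism `ν` with `ν(S) = S` and `φ ∘ ν = −φ`, connected cylinders `{‖φ‖_∞ ≤ ℓ}` (`ℓ ≥ 1`), and ONE element `z` with `φ(z) ≠ 0` whose
  centraliser is cofinite (`∀ g, ∃ c ∈ C_Γ(z), c·g ∈ reps` — every central `z`, `CayleyNeg.repsOfCentral`);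
* `CayleySign Γ S` — the same plus a second automorphism `κ` with `κ(S) = S`, `φ ∘ κ = diag(1, −1) ∘ φ`.
From these: left multiplications are the frames (ONE type, the identity), `ν`/`κ` induce the central inversion / axis flip fixing `1`
(`autOfMulEquiv`), left multiplication by `z` is a skeleton translation CENTRALISED by the left multiplications by `C_Γ(z)` — a `CentralShift`
(file `PlanarSkeletonCentralShift`), so Φ2 at `p_c` is DERIVED (Martineau–Severo) and:
**THEOREM (`CayleySign.criticalContinuity`, unconditional): `θ_g(p_c) = 0` at every `g ∈ Γ` on `Cay(Γ; S)`.**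
**THEOREM (`CayleyNeg.criticalContinuity_of_negNode₁`): the same for `CayleyNeg`, modulo the N1 node `SamePDropOfSkeletonNeg₁`.**
(Sibling file `CayleySkeletonLine`: ONE additive height `ψ : Γ → ℤ` with `ψ ∘ ν = −ψ` gives `θ(p_c) = 0` on `Cay(Γ; S) □ ℤ`, no central
element needed; sibling file `CayleySkeletonKernel`: the cylinder-connectivity hypothesis from "`S ∩ ker φ` generates `ker φ`".)
WHAT THIS REACHES BEYOND THE HAND-ROLLED ROWS: generating systems that MIX a central `ℤ`-factor with the rest (`Cay(H₃ × ℤ; a, b, t, at)`,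
not a box-product graph), every `Γ′ × ℤ^k` (`k ≥ 1`, resp. `k ≥ 2` for `CayleyNeg`) with admissible generators, `ℤ^d`-Cayley graphs of unit
range in two coordinates and ARBITRARY range in the others (every `d`), virtually-central extensions.  What it does not reach: groups whose
FC-centre lies in `ker φ` for every admissible `φ` (`N_{m,2}`, `N_{2,3}`: tier 2′), skeleton-free groups (tier 3c).
* §1 `Cay(Γ;S)` is locally finite (`instLocallyFiniteMulCayley`), `degree_mulCayley_le`, left multiplications `leftMulIso`, `autOfMulEquiv`;
* §2 `CayleyNeg`, `φ_one`, `φ_inv`, `φ_inv_mul`, **`CayleyNeg.skeleton : PlanarSkeletonNeg (Cay Γ S)`** (one type `{1}`), **`CayleyNeg.centralShift`**;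
* §3 `CayleySign`, **`CayleySign.skeletonSign : PlanarSkeletonSign`**, **`CayleySign.criticalContinuity`**; §4 `CayleyNeg.criticalContinuity_of_negNode₁`;
* §5 `repsOfCentral`, `CayleyNeg.ofCentral` (central translating element).
[cite: BenjaminiSchramm1996, Conj. 4; §2 (Cayley graphs, quotients)] [cite: MartineauSevero2019, Cor. 2.2]
[cite: KozmaNitzan2024, §1 p. 2 (approach 1); §4 p. 16 (Lemma 8: the lattice symmetries)] [cite: GrimmettPercolation1999, §12.1 p. 349]
-/

noncomputable section

namespace Summit.CriticalPhenomena.PercolationContinuityZ3.Theorems.Transplant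

open MeasureTheory Literature.Probability.Percolation Literature.Probability.LatticeModels SimpleGraph
open Literature.Barriers.CriticalPhenomena (countable_of_connected_of_locallyFinite)
open scoped Classical

/-! ## §1 The right Cayley graph `Cay(Γ; S) = SimpleGraph.mulCayley ↑S` of a finite generating system -/

section Cayley

variable {Γ : Type} [Group Γ] (S : Finset Γ)

/-- The neighbours of `u` in `Cay(Γ; S)` lie in `u·S ∪ u·S⁻¹`. [cite: BenjaminiSchramm1996, §2 (Cayley graphs)] -/
theorem neighborSet_mulCayley_subset (u : Γ) :
    (mulCayley (S : Set Γ)).neighborSet u ⊆ ↑(S.image (u * ·) ∪ S.image fun s => u * s⁻¹) := by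
  intro v hv
  rw [mem_neighborSet, mulCayley_adj] at hv
  obtain ⟨-, h | h⟩ := hv
  · rw [Finset.coe_union, Finset.coe_image, Finset.coe_image]
    exact Or.inl ⟨u⁻¹ * v, h, mul_inv_cancel_left u v⟩
  · rw [Finset.coe_union, Finset.coe_image, Finset.coe_image]
    exact Or.inr ⟨v⁻¹ * u, h, by group⟩

/-- **`Cay(Γ; S)` is locally finite** for a finite generating system. [cite: BenjaminiSchramm1996, §2 (Cayley graphs)] -/
instance instLocallyFiniteMulCayley : (mulCayley (S : Set Γ)).LocallyFinite := fun u =>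
  ((Finset.finite_toSet _).subset (neighborSet_mulCayley_subset S u)).fintype

/-- **Degree bound `deg ≤ 2|S|`** in `Cay(Γ; S)`. [cite: BenjaminiSchramm1996, §2 (Cayley graphs)] -/
theorem degree_mulCayley_le (u : Γ) : (mulCayley (S : Set Γ)).degree u ≤ 2 * S.card := by
  rw [← card_neighborFinset_eq_degree]
  calc ((mulCayley (S : Set Γ)).neighborFinset u).card ≤ (S.image (u * ·) ∪ S.image fun s => u * s⁻¹).card := by
        refine Finset.card_le_card fun v hv => ?_
        have hv' : v ∈ (mulCayley (S : Set Γ)).neighborSet u := by rwa [mem_neighborFinset] at hv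
        exact_mod_cast neighborSet_mulCayley_subset S u hv'
    _ ≤ (S.image (u * ·)).card + (S.image fun s => u * s⁻¹).card := Finset.card_union_le _ _
    _ ≤ S.card + S.card := add_le_add Finset.card_image_le Finset.card_image_le
    _ = 2 * S.card := by ring

/-- **Left multiplications are automorphisms of the right Cayley graph** (the frames). [cite: BenjaminiSchramm1996, §2 (Cayley graphs)] -/
def leftMulIso (g : Γ) : mulCayley (S : Set Γ) ≃g mulCayley (S : Set Γ) where
  toEquiv := Equiv.mulLeft g
  map_rel_iff' := fun {a b} => by
    show (mulCayley (S : Set Γ)).Adj (g * a) (g * b) ↔ (mulCayley (S : Set Γ)).Adj a b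
    exact mulCayley_adj_mul_iff_right

/-- `leftMulIso g w = g·w`. [folklore] -/
@[simp] theorem leftMulIso_apply (g w : Γ) : leftMulIso S g w = g * w := rfl

/-- **A group automorphism preserving `S` is an automorphism of `Cay(Γ; S)` fixing `1`** (the lifted point group).
[cite: KozmaNitzan2024, §4 p. 16 (Lemma 8: the lattice symmetries)] -/
def autOfMulEquiv (σ : Γ ≃* Γ) (hσ : ∀ s, σ s ∈ S ↔ s ∈ S) : mulCayley (S : Set Γ) ≃g mulCayley (S : Set Γ) where
  toEquiv := σ.toEquiv
  map_rel_iff' := fun {a b} => by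
    show (mulCayley (S : Set Γ)).Adj (σ a) (σ b) ↔ (mulCayley (S : Set Γ)).Adj a b
    rw [mulCayley_adj, mulCayley_adj, ← map_inv, ← map_mul, ← map_inv, ← map_mul, Finset.mem_coe, Finset.mem_coe, hσ, hσ,
      Finset.mem_coe, Finset.mem_coe, σ.injective.ne_iff]

/-- `autOfMulEquiv σ _ w = σ w`. [folklore] -/
@[simp] theorem autOfMulEquiv_apply (σ : Γ ≃* Γ) (hσ : ∀ s, σ s ∈ S ↔ s ∈ S) (w : Γ) : autOfMulEquiv S σ hσ w = σ w := rfl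

end Cayley

/-! ## §2 `CayleyNeg`: homomorphic skeleton, one reversing automorphism, connected cylinders, one cofinitely-centralised element off `ker φ` -/

/-- **INPUT (iii) of P4-GENERAL §22/§25 for a Cayley graph, `{±1}` version.**  A map `φ : Γ → ℤ²`, additive (`φ(gh) = φ g + φ h`), of sup-norm
`≤ 1` on the generators, with unit steps `φ(s_i) = e_i` realised in `S`; a group automorphism `ν` preserving `S` with `φ ∘ ν = −φ`; connected
cylinders `{‖φ‖_∞ ≤ ℓ}`, `ℓ ≥ 1`, in `Cay(Γ; S)`; and an element `z` with `φ(z) ≠ 0` whose centraliser meets every vertex cofinitely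
(`∀ g, ∃ c, cz = zc ∧ c·g ∈ reps`, i.e. `C_Γ(z)` has finite index — e.g. `z` central, `repsOfCentral`).
[cite: KozmaNitzan2024, §4 p. 16 (Lemma 8)] [cite: BenjaminiSchramm1996, §2; Conj. 4] [cite: MartineauSevero2019, Cor. 2.2] -/
structure CayleyNeg (Γ : Type) [Group Γ] (S : Finset Γ) where
  /-- the skeleton homomorphism `φ : Γ → ℤ²` -/
  φ : Γ → Site 2
  /-- additivity -/
  map_mul : ∀ g h : Γ, φ (g * h) = φ g + φ h
  /-- generators have sup-norm `≤ 1` -/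
  lip : ∀ s ∈ S, ∀ i : Fin 2, |φ s i| ≤ 1
  /-- unit steps: some generator maps to each basis vector -/
  step : ∀ i : Fin 2, ∃ s ∈ S, φ s = Pi.single i 1
  /-- the reversing automorphism -/
  ν : Γ ≃* Γ
  /-- `ν` preserves the generating system -/
  ν_mem : ∀ s, ν s ∈ S ↔ s ∈ S
  /-- `φ ∘ ν = −φ` -/
  ν_φ : ∀ g, φ (ν g) = -φ g
  /-- (κ) connected cylinders -/
  cyl_connected : ∀ ℓ : ℕ, 1 ≤ ℓ → ((mulCayley (S : Set Γ)).induce {g | φ g ∈ box 2 ℓ}).Connected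
  /-- the translating element -/
  z : Γ
  /-- `z ∉ ker φ` -/
  z_φ : φ z ≠ 0
  /-- finitely many representatives for the right cosets of the centraliser of `z` -/
  reps : Finset Γ
  /-- the centraliser of `z` is cofinite: every `g` is moved into `reps` by some `c ∈ C_Γ(z)` -/
  cofinite : ∀ g : Γ, ∃ c : Γ, c * z = z * c ∧ c * g ∈ reps

namespace CayleyNeg

variable {Γ : Type} [Group Γ] {S : Finset Γ} (D : CayleyNeg Γ S)

/-- `φ 1 = 0`. [folklore] -/
theorem φ_one : D.φ 1 = 0 := by
  have h := D.map_mul 1 1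
  rw [one_mul] at h
  exact add_eq_left.1 h.symm

/-- `φ g⁻¹ = −φ g`. [folklore] -/
theorem φ_inv (g : Γ) : D.φ g⁻¹ = -D.φ g := by
  have h := D.map_mul g⁻¹ g
  rw [inv_mul_cancel, φ_one] at h
  exact eq_neg_of_add_eq_zero_left h.symm

/-- `φ (u⁻¹ v) = φ v − φ u`. [folklore] -/
theorem φ_inv_mul (u v : Γ) : D.φ (u⁻¹ * v) = D.φ v - D.φ u := by
  rw [D.map_mul, φ_inv]; abel

/-- `φ` is sup-1-Lipschitz along the edges of `Cay(Γ; S)`. [folklore] -/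
theorem lip_adj {u v : Γ} (h : (mulCayley (S : Set Γ)).Adj u v) (i : Fin 2) : |D.φ u i - D.φ v i| ≤ 1 := by
  rw [mulCayley_adj] at h
  obtain ⟨-, h | h⟩ := h
  · have h1 := D.lip _ (Finset.mem_coe.1 h) i
    rw [φ_inv_mul, Pi.sub_apply, abs_sub_comm] at h1
    exact h1
  · have h1 := D.lip _ (Finset.mem_coe.1 h) i
    rw [φ_inv_mul, Pi.sub_apply] at h1
    exact h1

/-- A signed unit step `v ∼ v'` with `φ v' = φ v + σ e_i` (`σ = 1`: `v·s_i`; `σ = −1`: `v·s_i⁻¹`). [folklore] -/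
theorem exists_step (v : Γ) (i : Fin 2) (σ : ℤˣ) :
    ∃ v' : Γ, (mulCayley (S : Set Γ)).Adj v v' ∧ D.φ v' = D.φ v + Pi.single i (σ : ℤ) := by
  obtain ⟨s, hs, hφ⟩ := D.step i
  have hs1 : s ≠ 1 := by
    intro h
    have h0 := congrFun hφ i
    rw [h, φ_one] at h0
    simp at h0
  rcases Int.units_eq_one_or σ with rfl | rfl
  · refine ⟨v * s, ?_, by rw [D.map_mul, hφ, Units.val_one]⟩
    rw [mulCayley_adj]
    refine ⟨fun h => hs1 (mul_left_cancel (a := v) (by rw [mul_one]; exact h.symm)), Or.inl ?_⟩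
    rw [inv_mul_cancel_left]; exact Finset.mem_coe.2 hs
  · refine ⟨v * s⁻¹, ?_, by rw [D.map_mul, φ_inv, hφ, Units.val_neg, Units.val_one, Pi.single_neg]⟩
    rw [mulCayley_adj]
    refine ⟨fun h => hs1 (inv_eq_one.1 (mul_left_cancel (a := v) (by rw [mul_one]; exact h.symm))), Or.inr ?_⟩
    rw [mul_inv_rev, inv_inv, inv_mul_cancel_right]; exact Finset.mem_coe.2 hs

/-- **THE SKELETON OF A `CayleyNeg`**: `φ`, ONE type (the identity), left multiplications as frames, `ν` as the central inversion, degree bound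
`2|S|`, unit steps by generators, connected cylinders. [cite: KozmaNitzan2024, §4 p. 16 (Lemma 8)] [cite: BenjaminiSchramm1996, §2] -/
def skeleton : PlanarSkeletonNeg (mulCayley (S : Set Γ)) where
  φ := D.φ
  lip := fun _ _ h i => D.lip_adj h i
  types := {1}
  frame := fun v => ⟨1, Finset.mem_singleton_self 1, leftMulIso S v, mul_one v, fun w => by
    show D.φ (v * w) = D.φ w + (D.φ v - D.φ 1)
    rw [D.map_mul, φ_one, sub_zero, add_comm]⟩
  neg := fun t ht => by
    rw [Finset.mem_singleton] at ht
    subst ht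
    refine ⟨autOfMulEquiv S D.ν D.ν_mem, map_one D.ν, fun w => ?_⟩
    show D.φ (D.ν w) - D.φ 1 = -(D.φ w - D.φ 1)
    rw [φ_one, sub_zero, sub_zero, D.ν_φ]
  Δ := 2 * S.card
  degree_le := degree_mulCayley_le S
  step := D.exists_step
  cyl_connected := fun t ht ℓ hℓ => by
    rw [Finset.mem_singleton] at ht
    subst ht
    have e : {w | D.φ w - D.φ 1 ∈ box 2 ℓ} = {g | D.φ g ∈ box 2 ℓ} := by
      ext w; simp [φ_one]
    rw [e]
    exact D.cyl_connected ℓ hℓ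

/-- The skeleton map is `φ`. [folklore] -/
@[simp] theorem skeleton_φ : D.skeleton.φ = D.φ := rfl

/-- The skeleton has one type, the identity. [folklore] -/
@[simp] theorem skeleton_types : D.skeleton.types = {1} := rfl

/-- A coordinate in which `φ(z)` is non-zero. [folklore] -/
theorem exists_φ_z_ne : ∃ i : Fin 2, D.φ D.z i ≠ 0 := Function.ne_iff.1 D.z_φ

/-- **THE CENTRALISED TRANSLATION OF A `CayleyNeg`**: left multiplication by `z` translates the coordinate `i₀` (where `φ(z)_{i₀} ≠ 0`) by
`φ(z)_{i₀}` and is centralised by the left multiplications by `C_Γ(z)`, which move every vertex into `reps`. [cite: MartineauSevero2019, Cor. 2.2]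
[cite: BenjaminiSchramm1996, §2 (quotients)] -/
def centralShift : D.skeleton.CentralShift where
  τ := leftMulIso S D.z
  i₀ := Classical.choose D.exists_φ_z_ne
  M := D.φ D.z (Classical.choose D.exists_φ_z_ne)
  M_ne := Classical.choose_spec D.exists_φ_z_ne
  shift := fun w => by
    show D.φ (D.z * w) _ = D.φ w _ + _
    rw [D.map_mul, Pi.add_apply, add_comm]
  V₀ := D.reps
  comm := fun v => by
    obtain ⟨c, hcz, hcv⟩ := D.cofinite v
    refine ⟨leftMulIso S c, fun w => ?_, hcv⟩
    show c * (D.z * w) = D.z * (c * w)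
    rw [← mul_assoc, hcz, mul_assoc]

/-- **Φ2 at `p_c` on `Cay(Γ; S)` is a THEOREM** for every `CayleyNeg` (cylinders are strictly subcritical, Martineau–Severo).
[cite: MartineauSevero2019, Cor. 2.2] -/
theorem cylSubcritical_criticalProb (g : Γ) : D.skeleton.CylSubcritical (criticalProbIOf (mulCayley (S : Set Γ)) g) :=
  D.centralShift.cylSubcritical_criticalProb g

end CayleyNeg

/-! ## §3 `CayleySign` (+ the axis flip) and the unconditional theorem -/

/-- **INPUT (iii) of P4-GENERAL §22/§25, `(ℤ/2)²` version**: a `CayleyNeg` plus a second `S`-preserving group automorphism `κ` with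
`φ ∘ κ = (φ₀, −φ₁)`. [cite: KozmaNitzan2024, §4 p. 16 (Lemma 8)] [cite: BenjaminiSchramm1996, §2; Conj. 4] -/
structure CayleySign (Γ : Type) [Group Γ] (S : Finset Γ) extends CayleyNeg Γ S where
  /-- the axis flip -/
  κ : Γ ≃* Γ
  /-- `κ` preserves the generating system -/
  κ_mem : ∀ s, κ s ∈ S ↔ s ∈ S
  /-- `φ ∘ κ = flipSnd ∘ φ` -/
  κ_φ : ∀ g, φ (κ g) = flipSnd (φ g)

namespace CayleySign

variable {Γ : Type} [Group Γ] {S : Finset Γ} (D : CayleySign Γ S)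

/-- **THE SIGN SKELETON OF A `CayleySign`** (`κ` induces the axis flip at the identity). [cite: KozmaNitzan2024, §4 p. 16 (Lemma 8)] -/
def skeletonSign : PlanarSkeletonSign (mulCayley (S : Set Γ)) where
  toPlanarSkeletonNeg := D.toCayleyNeg.skeleton
  flip := fun t ht => by
    rw [CayleyNeg.skeleton_types, Finset.mem_singleton] at ht
    subst ht
    refine ⟨autOfMulEquiv S D.κ D.κ_mem, map_one D.κ, fun w => ?_⟩
    show D.φ (D.κ w) - D.φ 1 = flipSnd (D.φ w - D.φ 1)
    rw [D.toCayleyNeg.φ_one, sub_zero, sub_zero, D.κ_φ]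

/-- The sign skeleton forgets to the `CayleyNeg` skeleton. [folklore] -/
@[simp] theorem skeletonSign_toPlanarSkeletonNeg : D.skeletonSign.toPlanarSkeletonNeg = D.toCayleyNeg.skeleton := rfl

/-- **THEOREM (unconditional): `θ_g(p_c) = 0` at every vertex of `Cay(Γ; S)` for every group `Γ` and generating system `S` carrying a
`CayleySign`** — homomorphic planar skeleton, `S`-preserving automorphisms acting by `−I` and `diag(1,−1)`, connected cylinders, one
cofinitely-centralised element off `ker φ`; Φ2, `p_c < 1`, uniqueness, quasi-transitivity all derived.
builds on p205010 (kernel theorem, internal audit signed; external expert review pending).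
[cite: BenjaminiSchramm1996, Conj. 4; §2] [cite: MartineauSevero2019, Cor. 2.2] [cite: KozmaNitzan2024, §1 p. 2 (approach 1)] -/
theorem criticalContinuity (D : CayleySign Γ S) (g : Γ) :
    theta (mulCayley (S : Set Γ)) g (criticalProbIOf (mulCayley (S : Set Γ)) g) = 0 :=
  PlanarSkeletonSign.criticalContinuity_of_centralShift D.skeletonSign D.toCayleyNeg.centralShift g

end CayleySign

/-! ## §4 The `{±1}` version, modulo the N1 node -/

/-- **CONDITIONAL THEOREM: `θ_g(p_c) = 0` on `Cay(Γ; S)` for every `CayleyNeg`, modulo `SamePDropOfSkeletonNeg₁`** (one type; Φ2 derived).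
[cite: BenjaminiSchramm1996, Conj. 4; §2] [cite: MartineauSevero2019, Cor. 2.2] -/
theorem CayleyNeg.criticalContinuity_of_negNode₁ {Γ : Type} [Group Γ] {S : Finset Γ} (D : CayleyNeg Γ S)
    (hD : SamePDropOfSkeletonNeg₁) (g : Γ) : theta (mulCayley (S : Set Γ)) g (criticalProbIOf (mulCayley (S : Set Γ)) g) = 0 :=
  D.skeleton.criticalContinuity_of_negNode₁_centralShift hD D.skeleton_types D.centralShift g

/-! ## §5 Central elements: the cofiniteness datum for free -/

/-- **A CENTRAL element has the cofinite-centraliser property with `reps = {1}`** (`c := g⁻¹`). [folklore] -/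
theorem repsOfCentral {Γ : Type} [Group Γ] {z : Γ} (hz : ∀ g : Γ, g * z = z * g) (g : Γ) :
    ∃ c : Γ, c * z = z * c ∧ c * g ∈ ({1} : Finset Γ) := by
  refine ⟨g⁻¹, ?_, by rw [inv_mul_cancel]; exact Finset.mem_singleton_self 1⟩
  have h := hz g
  calc g⁻¹ * z = g⁻¹ * (z * g) * g⁻¹ := by group
    _ = g⁻¹ * (g * z) * g⁻¹ := by rw [h]
    _ = z * g⁻¹ := by group

/-- **`CayleyNeg` from a CENTRAL translating element** (all other data as given). [cite: BenjaminiSchramm1996, §2] -/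
def CayleyNeg.ofCentral {Γ : Type} [Group Γ] {S : Finset Γ} (φ : Γ → Site 2) (map_mul : ∀ g h : Γ, φ (g * h) = φ g + φ h)
    (lip : ∀ s ∈ S, ∀ i : Fin 2, |φ s i| ≤ 1) (step : ∀ i : Fin 2, ∃ s ∈ S, φ s = Pi.single i 1) (ν : Γ ≃* Γ)
    (ν_mem : ∀ s, ν s ∈ S ↔ s ∈ S) (ν_φ : ∀ g, φ (ν g) = -φ g)
    (cyl_connected : ∀ ℓ : ℕ, 1 ≤ ℓ → ((mulCayley (S : Set Γ)).induce {g | φ g ∈ box 2 ℓ}).Connected)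
    (z : Γ) (hz : ∀ g : Γ, g * z = z * g) (z_φ : φ z ≠ 0) : CayleyNeg Γ S where
  φ := φ
  map_mul := map_mul
  lip := lip
  step := step
  ν := ν
  ν_mem := ν_mem
  ν_φ := ν_φ
  cyl_connected := cyl_connected
  z := z
  z_φ := z_φ
  reps := {1}
  cofinite := repsOfCentral hz

end Summit.CriticalPhenomena.PercolationContinuityZ3.Theorems.Transplant

end
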